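import Summits.ABC.IUTFork.Cor312PilotIdelesDH
import Summits.ABC.IUTFork.Cor312ThetaFiniteDHVol
import Summits.ABC.IUTFork.Cor312SettingDHVolRoute
import Literature.IUT.LogVolume.DifferentConductorTower
import HarnessLib

/-!
# [IUTchIII] Corollary 3.12 over the REAL log-shells with the VERBATIM volumes and the Dupuy–Hilado pilot regions
# read off ideles: `BridgeHyps` UNCONDITIONALLY, `ThetaRegionsAdm`, and `Statement ⟸ GlobalVolumeTransport`

Record-only file (D-0012) of the abc-iut cell (Cor. 3.12 sub-crew, seat abc-iut-c312-3 = the L-DH level, gen 4;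
D-0067 TEAM A row A-0, box provider); TAKES NO SIDE. abc-iut-c312-5 (gen 3) reduced "`−|log(Θ)| ∈ ℝ`"
(`ThetaFinite`) for the real setting `Real.settingDHVol` to three conditions on the Θ-box binder
(`Cor312ThetaFiniteDHVol.thetaFinite_settingDHVol`: at every `(j ∈ 𝔽_l^⋇, p)` the union over `m` of the boxes is
bounded and non-degenerate; it is `𝒪_L` off a finite prime set), abc-iut-c312-6 (gen 4) reduced the printed
`Statement` there to hull-set-shaped boxes + `ThetaFinite` + TEAM B's global input (`Cor312SettingDHVolRoute`), and
`Cor312PilotIdelesDH` supplied `hθ`/`hfinθ`/`hq`/`hfin` for the SHARP Dupuy–Hilado boxes `ι_j(t_{Θ,j,v_j})·(R_I)^∼`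
read off Θ-ideles. THIS file discharges the remaining box conditions for those boxes:

* `thetaBoxDH_sharp_inr` — the sharp box at a prime IS the hull-set `λ_Θ·𝒪_L`, with Θ-centre
  `λ_{Θ,(v⃗,i)} = ψ_{v⃗}(ι_j(t_{Θ,j,v_j}))_i` (`Cor312ThetaBoxesDH.centreOf`)
  (`Cor312ThetaBoxesDH.boxOf_smul_normalizedPacket`; [IUTchIII] Rmk. 3.9.5 (ix) p. 128: the pilot objects are
  arithmetic line bundles, their regions hull-sets "`λ·𝒪`"); at `∞` it is everything, the hull-set over the empty
  index (`isHullSet_thetaBoxDH_sharp`);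
* `thetaBoxDH_sharp_eq_hullSet_one` — where the ideles are UNITS the box is `𝒪_L` itself (a hull-set depends only
  on the norms of its centre; `‖ψ(ι_j(a))_i‖ = ‖a‖`), so `{p | box ≠ 𝒪_L} ⊆` the primes under `S`
  (`finite_ne_unitBox_sharp`);
* hence **`thetaFinite_settingDHVolSharp`** ("`−|log(Θ)| ∈ ℝ`" PROVED for the sharp boxes) and
  **`bridgeHyps_settingDHVolSharp_of_ideles : BridgeHyps (settingDHVolSharp …)`** with NO residual beyond the idele
  binders (`t ≠ 0`, `‖t‖ = 1` off `S`; `tq ≠ 0`, `‖tq‖ = 1` off `S`) — every field of c312-6's `BridgeHyps` (mono,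
  image_adm, image_fin, hul_nonempty, theta_nonempty, finite = `ThetaFinite`) is a THEOREM for the assembled real
  Dupuy–Hilado setting; **`thetaRegionsAdm_settingDHVolSharp`** (abc-iut-c312-11's hypothesis, every Kummer image
  admissible); and **`statement_settingDHVolSharp_of_globalVolumeTransport`**: the printed `Statement` of Cor. 3.12 at
  this setting ⟸ TEAM B's gap input `GlobalVolumeTransport` (G-c312-11-1, kurims p. 184 l. 30–34) ALONE — NOT asserted
  here.
[claim: Mochizuki2012, status: disputed] for the quoted sentences; [cite: Mochizuki2012, IUTchIII Rmk. 3.9.5 (ix)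
p. 128]; [cite: DupuyHilado2025, §3.4, §3.9]. Whether `GlobalVolumeTransport` follows from [IUTchIII] Thm. 3.11 is the
cell's adjudication question (plan/ADJUDICATION-SPEC), untouched here. An instance ≠ an endorsement.
-/

noncomputable section

open Set Function NumberField IsDedekindDomain
open scoped Pointwise

namespace Summit.ABC

namespace IUTFork

namespace Thm311

namespace Real

open Cor312 Cor312Vol Literature.IUT.LogThetaLattice Literature.IUT.LogVolume Literature.NumberTheory.NumberFields

variable {F : Type} [Field F] [NumberField F] (X : PilotData F) {logv : PadicLogs F} (hlog : LogvAnalytic logv)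
  (t : ∀ (pp : Nat.Primes) (_ : Fin X.lstar) (x : (thetaIndex X).Fibre (.inr pp)),
    haveI : Fact (pp : ℕ).Prime := ⟨pp.2⟩; kOf X pp.1 x)

/-! ## §1. The sharp box is the hull-set `λ_Θ·𝒪_L` (every prime), everything (at `∞`), `𝒪_L` (at unit ideles) -/

/-- The coordinates of the Θ-centre have norm `‖t_{Θ,j,v_j}‖` (`‖ψ_{v⃗}(ι_j(a))_i‖ = ‖a‖`).
[cite: Mochizuki2012, IUTchIV Prop. 1.4 (i) p. 13] -/
theorem norm_thetaCentre_sharp (pp : Nat.Primes) (j : (thetaIndex X).Label)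
    (e : (thetaIndex X).Caps j → (thetaIndex X).Fibre (.inr pp))
    (i : haveI : Fact (pp : ℕ).Prime := ⟨pp.2⟩; DIdx pp.1 ((presAt X hlog pp).kk e)) :
    haveI : Fact (pp : ℕ).Prime := ⟨pp.2⟩
    ‖(presAt X hlog pp).centreOf (fun e =>
        iota pp.1 ((presAt X hlog pp).kk e) (Fin.last _) (labelIdele X t pp j (e (Fin.last _)))) ⟨e, i⟩‖ =
      ‖labelIdele X t pp j (e (Fin.last _))‖ := by
  haveI : Fact (pp : ℕ).Prime := ⟨pp.2⟩
  exact norm_dEquiv_iota pp.1 ((presAt X hlog pp).kk e) (Fin.last _) _ i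

/-- Every coordinate of the Θ-centre is non-zero (for non-zero ideles). [cite: Mochizuki2012, IUTchIV Prop. 1.4 (i) p. 13] -/
theorem thetaCentre_sharp_ne_zero (ht0 : ∀ pp i x, t pp i x ≠ 0) (pp : Nat.Primes) (j : (thetaIndex X).Label)
    (s : haveI : Fact (pp : ℕ).Prime := ⟨pp.2⟩; (presAt X hlog pp).factorIdx j) :
    haveI : Fact (pp : ℕ).Prime := ⟨pp.2⟩
    (presAt X hlog pp).centreOf (fun e =>
        iota pp.1 ((presAt X hlog pp).kk e) (Fin.last _) (labelIdele X t pp j (e (Fin.last _)))) s ≠ 0 := by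
  haveI : Fact (pp : ℕ).Prime := ⟨pp.2⟩
  obtain ⟨e, i⟩ := s
  exact dEquiv_iota_ne_zero pp.1 ((presAt X hlog pp).kk e) (Fin.last _) (labelIdele_ne_zero X t ht0 pp j _) i

/-- **The sharp Θ-box at a prime IS the hull-set `λ_Θ·𝒪_L`** (box of translated unit balls).
[cite: Mochizuki2012, IUTchIII Rmk. 3.9.5 (ix) p. 128] -/
theorem thetaBoxDH_sharp_inr (ht0 : ∀ pp i x, t pp i x ≠ 0) (j : (thetaIndex X).Label) (pp : Nat.Primes) :
    thetaBoxDH X hlog (sharpBoxDH X hlog t) j (.inr pp) =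
      haveI : Fact (pp : ℕ).Prime := ⟨pp.2⟩
      hullSet ((presAt X hlog pp).factorField j) ((presAt X hlog pp).centreOf fun e =>
        iota pp.1 ((presAt X hlog pp).kk e) (Fin.last _) (labelIdele X t pp j (e (Fin.last _)))) := by
  haveI : Fact (pp : ℕ).Prime := ⟨pp.2⟩
  exact (presAt X hlog pp).boxOf_smul_normalizedPacket _ fun e i =>
    dEquiv_iota_ne_zero pp.1 ((presAt X hlog pp).kk e) (Fin.last _) (labelIdele_ne_zero X t ht0 pp j _) i

/-- At the archimedean place the sharp Θ-box is everything (no field factor in the parent files' modelling choice).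
[folklore] -/
theorem thetaBoxDH_sharp_inl (u : Unit) (j : (thetaIndex X).Label) :
    thetaBoxDH X hlog (sharpBoxDH X hlog t) j (.inl u) = Set.univ :=
  rfl

/-- The factor index at `∞` is empty. [folklore] -/
theorem isEmpty_factorIdxDH_inl (u : Unit) (j : (thetaIndex X).Label) : IsEmpty (factorIdxDH X hlog j (.inl u)) := by
  rw [factorIdxDH]
  infer_instance

/-- **Every sharp Θ-box is a hull-set**, at every place: `λ_Θ·𝒪_L` at a prime, the hull-set over the EMPTY index
(= everything) at `∞` ([IUTchIII] Rmk. 3.9.5 (ix): the Θ-pilot object is an arithmetic line bundle).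
[cite: Mochizuki2012, IUTchIII Rmk. 3.9.5 (ix) p. 128] -/
theorem isHullSet_thetaBoxDH_sharp (ht0 : ∀ pp i x, t pp i x ≠ 0) (j : (thetaIndex X).Label) :
    ∀ vQ : (thetaIndex X).VQ, IsHullSet (factorFieldDH X hlog j vQ) (thetaBoxDH X hlog (sharpBoxDH X hlog t) j vQ)
  | .inl u => by
    haveI := isEmpty_factorIdxDH_inl X hlog u j
    refine ⟨fun s => isEmptyElim s, fun s => isEmptyElim s, ?_⟩
    rw [thetaBoxDH_sharp_inl]
    exact (Set.eq_univ_of_forall fun y => (mem_polydisc _).2 fun s => isEmptyElim s).symm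
  | .inr pp => ⟨_, thetaCentre_sharp_ne_zero X hlog t ht0 pp j, thetaBoxDH_sharp_inr X hlog t ht0 j pp⟩

/-- **Where the Θ-ideles are units, the sharp box at `(i+1, p)` is `𝒪_L` itself**: a hull-set depends only on the
norms of its centre, and `‖λ_{Θ,(v⃗,i)}‖ = ‖t_{Θ,i+1,v_{i+1}}‖ = 1`. (Off `S` this is Dupuy–Hilado's "`𝒪_{v⃗}` at the
good places"; [IUTchIV] Thm. 1.10 Step (vi).) [cite: DupuyHilado2025, §3.9] -/
theorem thetaBoxDH_sharp_eq_hullSet_one (ht0 : ∀ pp i x, t pp i x ≠ 0) (i : Fin (thetaIndex X).lstar)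
    (pp : Nat.Primes)
    (h1 : ∀ x : (thetaIndex X).Fibre (.inr pp), haveI : Fact (pp : ℕ).Prime := ⟨pp.2⟩; ‖t pp i x‖ = 1) :
    thetaBoxDH X hlog (sharpBoxDH X hlog t) (Setting.labelSucc i) (.inr pp) =
      hullSet (factorFieldDH X hlog (Setting.labelSucc i) (.inr pp)) (fun _ => 1) := by
  haveI : Fact (pp : ℕ).Prime := ⟨pp.2⟩
  rw [thetaBoxDH_sharp_inr X hlog t ht0]
  show polydisc _ _ = polydisc _ _
  congr 1
  funext s
  obtain ⟨e, k⟩ := s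
  rw [norm_one, norm_thetaCentre_sharp, labelIdele_labelSucc, h1]

/-- **The primes where the sharp box is not `𝒪_L` lie under `S`** (for Θ-ideles that are units off `S`), a finite
set. [cite: DupuyHilado2025, §3.9] -/
theorem finite_ne_unitBox_sharp (ht0 : ∀ pp i x, t pp i x ≠ 0)
    (ht1 : ∀ (pp : Nat.Primes) (i : Fin X.lstar) (x : (thetaIndex X).Fibre (.inr pp)),
      haveI : Fact (pp : ℕ).Prime := ⟨pp.2⟩; placeOf X pp.1 x ∉ X.S → ‖t pp i x‖ = 1)
    (i : Fin (thetaIndex X).lstar) :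
    {pp : Nat.Primes | thetaBoxDH X hlog (sharpBoxDH X hlog t) (Setting.labelSucc i) (.inr pp) ≠
      hullSet (factorFieldDH X hlog (Setting.labelSucc i) (.inr pp)) (fun _ => 1)}.Finite := by
  refine (finite_primes_under_S X).subset fun pp hpp => ?_
  haveI : Fact (pp : ℕ).Prime := ⟨pp.2⟩
  by_contra hS
  refine hpp (thetaBoxDH_sharp_eq_hullSet_one X hlog t ht0 i pp fun x => ht1 pp i x fun hx => ?_)
  exact hS ⟨_, hx, natCast_mem_placeOf X pp.1 x⟩

/-! ## §2. `BridgeHyps`, `ThetaRegionsAdm`, `Statement ⟸ GlobalVolumeTransport` for `settingDHVolSharp` -/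

section Capstone

variable (tq : ∀ (pp : Nat.Primes) (x : (thetaIndex X).Fibre (.inr pp)),
    haveI : Fact (pp : ℕ).Prime := ⟨pp.2⟩; kOf X pp.1 x)
  (M : Type) [Field M] [NumberField M]
  (archPk : ∀ (j : (thetaIndex X).Label) (vQ : (thetaIndex X).VQ), Set ((logShellsDH X logv).Packet j vQ))
  (archSub : ∀ (j : (thetaIndex X).Label) (v : (thetaIndex X).V),
    Set ((logShellsDH X logv).Packet j ((thetaIndex X).over v)))
  (Ψ : ℤ → ∀ v : (thetaIndex X).V, v ∈ (thetaIndex X).Vbad → Set ((logShellsDH X logv).StarPacket v))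
  (act : ℤ → ∀ v : (thetaIndex X).V, v ∈ (thetaIndex X).Vbad →
    (logShellsDH X logv).StarPacket v → Module.End ℚ ((logShellsDH X logv).StarPacket v))
  (Mmod : ℤ → ∀ j : (thetaIndex X).LabelStar, Set ((logShellsDH X logv).GlobalPacket j.1))
  (region : ℤ → ∀ j : (thetaIndex X).LabelStar, FinDivisor M → ∀ vQ : (thetaIndex X).VQ,
    Set ((logShellsDH X logv).Packet j.1 vQ))
  (n : ℤ) {HT : Type} {LogLink : HT → HT → Type} {IsFull : ∀ {s t : HT}, LogLink s t → Prop}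
  (lat : LGPGaussianLogThetaLattice LogLink IsFull)
  {Frd : Type} {IsoF : Frd → Frd → Type} {Ob : Frd → Type} {realify : Frd → Frd} {Strip : Type}
  {IsoS : Strip → Strip → Type} {Mv : ∀ v : (thetaIndex X).V, v ∈ (thetaIndex X).Vbad → Type}
  [∀ v h, Monoid (Mv v h)]
  (sig : GlobalLGPFrobenioidSignature (thetaIndex X).lstar (thetaIndex X).V (· ∈ (thetaIndex X).Vbad)
    Frd IsoF Ob realify Strip IsoS Mv)
  (split : SplittingMonoids Mv) {ObΔ : Type} {N : ∀ v : (thetaIndex X).V, v ∈ (thetaIndex X).Vbad → Type}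
  [∀ v h, Monoid (N v h)] (qData : QPilotData ObΔ N)

/-- The union over the Kummer index of the (constant) sharp boxes is the sharp box. [folklore] -/
theorem iUnion_thetaBoxDH_sharp (j : (thetaIndex X).Label) (vQ : (thetaIndex X).VQ) :
    (⋃ _m : ℤ, thetaBoxDH X hlog (sharpBoxDH X hlog t) j vQ) = thetaBoxDH X hlog (sharpBoxDH X hlog t) j vQ :=
  Set.iUnion_const _

/-- **"`−|log(Θ)| ∈ ℝ`" for `settingDHVolSharp`** (`ThetaFinite`, the first clause of Cor. 3.12, kurims p. 174
l. 16): abc-iut-c312-5's `thetaFinite_settingDHVol` with its three box conditions DISCHARGED for the sharp boxes —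
bounded and non-degenerate because the box is the hull-set `λ_Θ·𝒪_L`, equal to `𝒪_L` off the primes under `S`.
[claim: Mochizuki2012, status: disputed] -/
theorem thetaFinite_settingDHVolSharp (ht0 : ∀ pp i x, t pp i x ≠ 0)
    (ht1 : ∀ (pp : Nat.Primes) (i : Fin X.lstar) (x : (thetaIndex X).Fibre (.inr pp)),
      haveI : Fact (pp : ℕ).Prime := ⟨pp.2⟩; placeOf X pp.1 x ∉ X.S → ‖t pp i x‖ = 1)
    (htq0 : ∀ pp x, tq pp x ≠ 0)
    (htq1 : ∀ (pp : Nat.Primes) (x : (thetaIndex X).Fibre (.inr pp)),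
      haveI : Fact (pp : ℕ).Prime := ⟨pp.2⟩; placeOf X pp.1 x ∉ X.S → ‖tq pp x‖ = 1) :
    (settingDHVolSharp X hlog M archPk archSub Ψ act Mmod region n lat sig split qData tq t htq0 htq1).ThetaFinite := by
  refine thetaFinite_settingDHVol X hlog M archPk archSub Ψ act Mmod region n lat sig split qData _ _ _ _
    (fun i pp => ?_) (fun i pp => ?_) (fun i => ?_)
  · rw [iUnion_thetaBoxDH_sharp]
    exact (isHullSet_thetaBoxDH_sharp X hlog t ht0 (Setting.labelSucc i) (.inr pp)).isBounded
  · rw [iUnion_thetaBoxDH_sharp]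
    exact (isHullSet_thetaBoxDH_sharp X hlog t ht0 (Setting.labelSucc i) (.inr pp)).isNondegenerate
  · refine (finite_ne_unitBox_sharp X hlog t ht0 ht1 i).subset fun pp hpp => ?_
    rwa [Set.mem_setOf_eq, iUnion_thetaBoxDH_sharp] at hpp

/-- **c312-6's `BridgeHyps` for the real setting with the verbatim volumes and the sharp Dupuy–Hilado pilot regions
— EVERY FIELD A THEOREM** (mono, image_adm, image_fin, hul_nonempty, theta_nonempty by abc-iut-c312-5 gen 2; hθ,
hfinθ, hq, hfin by `Cor312PilotIdelesDH`; `ThetaFinite` by `thetaFinite_settingDHVolSharp`). Left: only the idele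
binders — Θ-ideles and `q`-ideles non-zero and units off `S` (consequences of realising `P_Θ`, `P_q`:
`norm_eq_one_of_realises`; inhabited: §3). [claim: Mochizuki2012, status: disputed] -/
theorem bridgeHyps_settingDHVolSharp_of_ideles (ht0 : ∀ pp i x, t pp i x ≠ 0)
    (ht1 : ∀ (pp : Nat.Primes) (i : Fin X.lstar) (x : (thetaIndex X).Fibre (.inr pp)),
      haveI : Fact (pp : ℕ).Prime := ⟨pp.2⟩; placeOf X pp.1 x ∉ X.S → ‖t pp i x‖ = 1)
    (htq0 : ∀ pp x, tq pp x ≠ 0)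
    (htq1 : ∀ (pp : Nat.Primes) (x : (thetaIndex X).Fibre (.inr pp)),
      haveI : Fact (pp : ℕ).Prime := ⟨pp.2⟩; placeOf X pp.1 x ∉ X.S → ‖tq pp x‖ = 1) :
    BridgeHyps (settingDHVolSharp X hlog M archPk archSub Ψ act Mmod region n lat sig split qData tq t htq0 htq1) :=
  bridgeHyps_settingDHVolSharp X hlog M archPk archSub Ψ act Mmod region n lat sig split qData tq t ht0 ht1 htq0 htq1
    (thetaFinite_settingDHVolSharp X hlog t tq M archPk archSub Ψ act Mmod region n lat sig split qData ht0 ht1 htq0 htq1)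

/-- **abc-iut-c312-11's `ThetaRegionsAdm` for `settingDHVolSharp`** — every `(n, m)`-Kummer image of the Θ-pilot
object is admissible (each is the preimage of the hull-set `λ_Θ·𝒪_L`; abc-iut-c312-6's
`thetaRegionsAdm_settingDHVol_of_isHullSet`). [claim: Mochizuki2012, status: disputed] -/
theorem thetaRegionsAdm_settingDHVolSharp (ht0 : ∀ pp i x, t pp i x ≠ 0) (htq0 : ∀ pp x, tq pp x ≠ 0)
    (htq1 : ∀ (pp : Nat.Primes) (x : (thetaIndex X).Fibre (.inr pp)),
      haveI : Fact (pp : ℕ).Prime := ⟨pp.2⟩; placeOf X pp.1 x ∉ X.S → ‖tq pp x‖ = 1) :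
    ThetaRegionsAdm (settingDHVolSharp X hlog M archPk archSub Ψ act Mmod region n lat sig split qData tq t htq0
      htq1) :=
  thetaRegionsAdm_settingDHVol_of_isHullSet X hlog M archPk archSub Ψ act Mmod region n lat sig split qData _ _ _ _
    fun _ i vQ => isHullSet_thetaBoxDH_sharp X hlog t ht0 (Setting.labelSucc i) vQ

/-- **The printed `Statement` of [IUTchIII] Cor. 3.12 for `settingDHVolSharp` ⟸ TEAM B's gap input
`GlobalVolumeTransport` ALONE** (G-c312-11-1, kurims p. 184 l. 30–34 — NOT asserted): abc-iut-c312-6's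
`statement_settingDHVol_of_globalVolumeTransport` with its side conditions (hull-set-shaped Θ-boxes, `ThetaFinite`)
DISCHARGED for the real Dupuy–Hilado setting with pilot regions read off ideles. Whether the input follows from
[IUTchIII] Thm. 3.11 is the cell's adjudication question. [claim: Mochizuki2012, status: disputed] -/
theorem statement_settingDHVolSharp_of_globalVolumeTransport (ht0 : ∀ pp i x, t pp i x ≠ 0)
    (ht1 : ∀ (pp : Nat.Primes) (i : Fin X.lstar) (x : (thetaIndex X).Fibre (.inr pp)),
      haveI : Fact (pp : ℕ).Prime := ⟨pp.2⟩; placeOf X pp.1 x ∉ X.S → ‖t pp i x‖ = 1)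
    (htq0 : ∀ pp x, tq pp x ≠ 0)
    (htq1 : ∀ (pp : Nat.Primes) (x : (thetaIndex X).Fibre (.inr pp)),
      haveI : Fact (pp : ℕ).Prime := ⟨pp.2⟩; placeOf X pp.1 x ∉ X.S → ‖tq pp x‖ = 1)
    (hgvt : GlobalVolumeTransport
      (settingDHVolSharp X hlog M archPk archSub Ψ act Mmod region n lat sig split qData tq t htq0 htq1)) :
    (settingDHVolSharp X hlog M archPk archSub Ψ act Mmod region n lat sig split qData tq t htq0 htq1).Statement :=
  statement_settingDHVol_of_globalVolumeTransport X hlog M archPk archSub Ψ act Mmod region n lat sig split qData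
    _ _ _ _ (fun _ i vQ => isHullSet_thetaBoxDH_sharp X hlog t ht0 (Setting.labelSucc i) vQ)
    (thetaFinite_settingDHVolSharp X hlog t tq M archPk archSub Ψ act Mmod region n lat sig split qData ht0 ht1 htq0 htq1)
    hgvt

end Capstone

/-! ## §3. Non-vacuity: Θ-ideles REALISING `P_Θ` exist as soon as `2l ∣ ord_v(q_v)` on `S` -/

/-- **Realising Θ-ideles exist** (vacuity audit of the idele binders, LANA Rem. 8.2.1 discipline): if at every bad
place `v ∈ S` the valuation `ord_v(q_v)` is divisible by `2l` — for a collection of initial Θ-data this holds in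
`K ⊇ F(E[2l])` because `q̲_v = q_v^{1/2l} ∈ K_v̲` ([IUTchI] Ex. 3.2 (iv)); here `F` plays `K` — then there are
Θ-ideles `t_{Θ,j,v} ∈ F_v^×` with `log ‖t_{Θ,j,v}‖ = −P_{Θ,j}(v)·ln|κ(v)|/n_v` (Dupuy–Hilado (3.4)): powers of a norm
uniformizer (campaign-S `RescaledCompletion.exists_units_log_norm_eq`) at `v ∈ S`, and `1` off `S`. In particular
the binders `t ≠ 0`, "`‖t‖ = 1` off `S`" of `bridgeHyps_settingDHVolSharp_of_ideles` are inhabited by ideles that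
realise `P_Θ` (`norm_eq_one_of_realises`). [cite: Mochizuki2012, IUTchI Ex. 3.2 (iv) p. 71] -/
theorem exists_realising_thetaIdeles (hdiv : ∀ v ∈ X.S, (2 * X.l : ℤ) ∣ X.ordq v) :
    ∃ t : ∀ (pp : Nat.Primes) (_ : Fin X.lstar) (x : (thetaIndex X).Fibre (.inr pp)),
        haveI : Fact (pp : ℕ).Prime := ⟨pp.2⟩; kOf X pp.1 x,
      (∀ pp i x, t pp i x ≠ 0) ∧
        ∀ (pp : Nat.Primes) (i : Fin X.lstar) (x : (thetaIndex X).Fibre (.inr pp)),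
          haveI : Fact (pp : ℕ).Prime := ⟨pp.2⟩
          Real.log ‖t pp i x‖ = -(X.thetaPilot i (placeOf X pp.1 x)) * logNorm F (placeOf X pp.1 x) /
            localDegree F (placeOf X pp.1 x) := by
  classical
  have key : ∀ (pp : Nat.Primes) (i : Fin X.lstar) (x : (thetaIndex X).Fibre (.inr pp)),
      ∃ a : (haveI : Fact (pp : ℕ).Prime := ⟨pp.2⟩; kOf X pp.1 x), a ≠ 0 ∧
        (haveI : Fact (pp : ℕ).Prime := ⟨pp.2⟩
         Real.log ‖a‖ = -(X.thetaPilot i (placeOf X pp.1 x)) * logNorm F (placeOf X pp.1 x) /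
          localDegree F (placeOf X pp.1 x)) := by
    intro pp i x
    haveI : Fact (pp : ℕ).Prime := ⟨pp.2⟩
    set v := placeOf X pp.1 x with hv
    have hpv : ((pp : ℕ) : 𝓞 F) ∈ v.asIdeal := natCast_mem_placeOf X pp.1 x
    by_cases hS : v ∈ X.S
    · obtain ⟨m, hm⟩ := hdiv v hS
      obtain ⟨a, ha⟩ := RescaledCompletion.exists_units_log_norm_eq F pp.1 v hpv ((((i : ℕ) : ℤ) + 1) ^ 2 * m)
      refine ⟨(a : kOf X pp.1 x), a.ne_zero, ?_⟩
      have hl : (X.l : ℝ) ≠ 0 := by exact_mod_cast X.l_prime.ne_zero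
      have he : (ramIdx F v : ℝ) ≠ 0 := by exact_mod_cast ramIdx_ne_zero F v
      have hf : (resDeg F v : ℝ) ≠ 0 := by exact_mod_cast resDeg_ne_zero F v
      have hordq : (X.ordq v : ℝ) = 2 * X.l * m := by exact_mod_cast hm
      rw [show Real.log ‖(a : kOf X pp.1 x)‖ = Real.log ‖(a : RescaledCompletion F pp.1 v hpv)‖ from rfl, ha,
        X.thetaPilot_apply_of_mem i hS, logNorm_eq, localDegree, residueChar_eq_of_natCast_mem pp.1 hpv,
        ← ramIdx_eq, hordq]
      simp only [← hv]
      push_cast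
      field_simp
    · refine ⟨1, one_ne_zero, ?_⟩
      rw [norm_one, Real.log_one, X.thetaPilot_apply_of_not_mem i hS, neg_zero, zero_mul, zero_div]
  choose t ht0 ht using key
  exact ⟨t, ht0, ht⟩



/-- **Realising `q`-ideles exist** under the same divisibility: `t_{q,v} ∈ F_v^×` with
`log ‖t_{q,v}‖ = −P_q(v)·ln|κ(v)|/n_v`, `P_q(v) = ord_v(q_v)/(2l)` (Dupuy–Hilado §3.3), `1` off `S` — so the binders
`tq ≠ 0`, "`‖tq‖ = 1` off `S`" are inhabited by ideles realising `P_q`. [cite: Mochizuki2012, IUTchI Ex. 3.2 (iv) p. 71] -/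
theorem exists_realising_qIdeles (hdiv : ∀ v ∈ X.S, (2 * X.l : ℤ) ∣ X.ordq v) :
    ∃ tq : ∀ (pp : Nat.Primes) (x : (thetaIndex X).Fibre (.inr pp)),
        haveI : Fact (pp : ℕ).Prime := ⟨pp.2⟩; kOf X pp.1 x,
      (∀ pp x, tq pp x ≠ 0) ∧
        ∀ (pp : Nat.Primes) (x : (thetaIndex X).Fibre (.inr pp)),
          haveI : Fact (pp : ℕ).Prime := ⟨pp.2⟩
          Real.log ‖tq pp x‖ = -(X.qPilot (placeOf X pp.1 x)) * logNorm F (placeOf X pp.1 x) /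
            localDegree F (placeOf X pp.1 x) := by
  classical
  have key : ∀ (pp : Nat.Primes) (x : (thetaIndex X).Fibre (.inr pp)),
      ∃ a : (haveI : Fact (pp : ℕ).Prime := ⟨pp.2⟩; kOf X pp.1 x), a ≠ 0 ∧
        (haveI : Fact (pp : ℕ).Prime := ⟨pp.2⟩
         Real.log ‖a‖ = -(X.qPilot (placeOf X pp.1 x)) * logNorm F (placeOf X pp.1 x) /
          localDegree F (placeOf X pp.1 x)) := by
    intro pp x
    haveI : Fact (pp : ℕ).Prime := ⟨pp.2⟩
    set v := placeOf X pp.1 x with hv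
    have hpv : ((pp : ℕ) : 𝓞 F) ∈ v.asIdeal := natCast_mem_placeOf X pp.1 x
    by_cases hS : v ∈ X.S
    · obtain ⟨m, hm⟩ := hdiv v hS
      obtain ⟨a, ha⟩ := RescaledCompletion.exists_units_log_norm_eq F pp.1 v hpv m
      refine ⟨(a : kOf X pp.1 x), a.ne_zero, ?_⟩
      have hl : (X.l : ℝ) ≠ 0 := by exact_mod_cast X.l_prime.ne_zero
      have he : (ramIdx F v : ℝ) ≠ 0 := by exact_mod_cast ramIdx_ne_zero F v
      have hf : (resDeg F v : ℝ) ≠ 0 := by exact_mod_cast resDeg_ne_zero F v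
      have hordq : (X.ordq v : ℝ) = 2 * X.l * m := by exact_mod_cast hm
      rw [show Real.log ‖(a : kOf X pp.1 x)‖ = Real.log ‖(a : RescaledCompletion F pp.1 v hpv)‖ from rfl, ha,
        X.qPilot_apply_of_mem hS, logNorm_eq, localDegree, residueChar_eq_of_natCast_mem pp.1 hpv,
        ← ramIdx_eq, hordq]
      simp only [← hv]
      push_cast
      field_simp
    · refine ⟨1, one_ne_zero, ?_⟩
      rw [norm_one, Real.log_one, X.qPilot_apply_of_not_mem hS, neg_zero, zero_mul, zero_div]
  choose tq htq0 htq using key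
  exact ⟨tq, htq0, htq⟩

end Real

end Thm311

end IUTFork

end Summit.ABC

end
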